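/-
Copyright (c) 2026 the pub-hodgecm-mathlib formalisation cell (harness21).  Prover seat hodgecm-mathlib-F0P3a-p03 (g20), 2026-09-02 (LH7 leaf ED. 3 road, O8b census §1:
the algebraic LOCAL half of the isotypy letter (O8b♭), second tool — the non-compact generator).
-/
import Literature.NumberTheory.Automorphic.IrreducibleClassesConstituents
import Literature.NumberTheory.Automorphic.SmoothCharacterOfCharacter
import Mathlib.Tactic.Module
import HarnessLib

/-!
# A smooth representation with a UNIQUE constituent `χ`: an operator `ρ(t)` central in `ρ(G)` with SCALAR SQUARE acts through `χ(t)`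

Topic `NumberTheory/Automorphic`; namespace `Literature.NumberTheory.Automorphic` (dot notation on ★ `IrrClass`).  THEOREMS ONLY: no definition, no named fact, no
instance, no notation, no `sorry`.  Companion of ★ `SmoothRepUniqueConstituentCompact` (F0P3a-p03 (g20), p850220: under the unique-constituent hypothesis every COMPACT subgroup
acts through `χ`, hence the subgroup `G°` they generate).  This file supplies the complementary ALGEBRAIC tool for a generator `t ∉ G°`:

THE MATHEMATICS.  Let `ρ` be a smooth representation of `G` on `V` whose only constituent (★ `IrrClass.IsConstituentOf`) is the class of an irreducible `τ` on which `G` acts through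
the character `χ` (e.g. `τ = ℂ_χ`).  Let `t ∈ G` be such that `ρ(t)` COMMUTES with every `ρ(g)` (`hcomm` — e.g. `G = ⟨G°, t⟩` with `G°` acting by scalars) and `ρ(t)² = c` is a
SCALAR (`hsq` — e.g. `t · (w t w⁻¹)` central with `w` compact, the centre acting by scalars on an irreducible ambient representation).  Then `ρ(t) = χ(t)` on `V`.  PROOF.  Write
`c = s²`.  The eigenspaces `U_{±s} = ker (ρ(t) ∓ s)` are `G`-stable (`hcomm`), `V = U_s + U_{−s}` (`v = (2s)⁻¹[(ρ(t)v + s v) + (s v − ρ(t) v)]`; `s = 0` forces `V = 0`), and on a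
NON-ZERO `U_ε` the smooth representation `U_ε` has a constituent (★ `IrrClass.exists_isConstituentOf`), which is `⟦τ⟧`; since `ρ(t) = ε` on `U_ε`, `t` acts by `ε` on every subquotient
of `U_ε` (`IsConstituentOf.apply_eq_smul_of_forall_apply_eq_smul`), so `τ.ρ t = ε`, i.e. `ε = χ(t)`.  Hence both components of `v` are `χ(t)`-eigenvectors of `ρ(t)`.
CONSUMER (cell `hodgecm-mathlib`, crux H413, line LH7, (O8b♭) local): at a place `v` of `L⁺` SPLIT in `L`, `U(Φ₂)(L⁺_v) ≅ GL₂(L_w) = ⟨GL₂(L_w)°, t⟩` with `t = diag(ϖ, 1)`,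
`t · (w t w⁻¹) = ϖ · 1` central (`w` the antidiagonal Weyl element, compact), so on the finite-adelic smooth vectors of a discrete automorphic `P₂` realising a character family,
`ρ(t)² = ω_{P₂}(ϖ · 1)` is a scalar and this file gives `ρ(t) = χ(t)` WITHOUT unitarity — correcting this seat's census `CENSUS-O8b-PKmultOneU2.F0P3ap03g20.md` §(O8b♭)(i), which had
priced the split places as «unitarity load-bearing» (the counterexample `[[1, ord det g],[0,1]]` there has NO scalar square: `ρ(t)² ≠ c`; in the automorphic situation the centre kills it).
* §1 `IsConstituentOf.apply_eq_smul_of_forall_apply_eq_smul` — a scalar action `σ t = a` passes to every constituent of `σ`;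
* §2 `IrrClass.apply_eq_smul_of_forall_isConstituentOf_eq_of_sq` (abstract `τ`) ∕ `…_eq_mk_ofChar_of_sq` (`τ = ℂ_χ`) — the theorem above.
HONEST LABEL: generic smooth representation theory ([BushnellHenniart2006] §2, §9.1; [BernsteinZelevinsky1976] §2.1); HC_CM is proved only modulo the printed citations of that
programme until its rung 0 closes; this file proves no printed citation of it.

## References
* [BushnellHenniart2006] C. J. Bushnell, G. Henniart, *The local Langlands conjecture for GL(2)*, Grundlehren 335 (2006), §2 (subquotients, §2.3 Lemma), §9.1 (twisting).
* [BernsteinZelevinsky1976] I. N. Bernstein, A. V. Zelevinsky, Russian Math. Surveys 31:3 (1976), §2.1–§2.3.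
-/

set_option autoImplicit false

noncomputable section

namespace Literature.NumberTheory.Automorphic

namespace IrrClass

universe u

variable {G : Type u} [Group G] [TopologicalSpace G]

/-! ## §1 A scalar action passes to constituents -/

/-- **A scalar action passes to every constituent**: if `σ t = a • id` on `V` and `⟦r⟧` is a constituent of `σ` (an irreducible subquotient `N₁ ⁄ N₂ ≅ r`), then `r.ρ t = a • id`.
[cite: BushnellHenniart2006, §2] -/
theorem IsConstituentOf.apply_eq_smul_of_forall_apply_eq_smul {V : Type*} [AddCommGroup V] [Module ℂ V] {σ : Representation ℂ G V}
    {r : SmoothIrrep G} (h : (IrrClass.mk r).IsConstituentOf σ) {t : G} {a : ℂ} (ht : ∀ w : V, σ t w = a • w) (z : r.V) :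
    r.ρ t z = a • z := by
  obtain ⟨r', hr', N₁, N₂, hle, ⟨φ⟩⟩ := h
  obtain ⟨e₀⟩ := (IrrClass.mk_eq_mk_iff r r').1 hr'.symm
  -- on the subquotient `N₁ ⁄ N₂`, `t` acts by `a`
  have hN₁ : ∀ y : ↥N₁.toSubmodule, N₁.toRepresentation t y = a • y := fun y => Subtype.ext (ht (y : V))
  have hQ : ∀ q : ↥N₁.toSubmodule ⧸ N₂.toSubmodule.comap N₁.toSubmodule.subtype,
      (N₁.toRepresentation.quotient (N₂.toSubmodule.comap N₁.toSubmodule.subtype) fun g _ hx ↦ N₂.apply_mem_toSubmodule g hx) t q = a • q := by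
    intro q
    obtain ⟨y, rfl⟩ := Submodule.Quotient.mk_surjective _ q
    rw [Representation.quotient_apply, Submodule.mapQ_apply, hN₁, Submodule.Quotient.mk_smul]
  -- transport along `r.ρ ≃ r'.ρ ≃ N₁ ⁄ N₂`
  have h1 := (e₀.trans φ).toIntertwiningMap.isIntertwining r.ρ _ t z
  rw [hQ, ← map_smul] at h1
  exact (e₀.trans φ).toLinearEquiv.injective h1

/-! ## §2 A `ρ(G)`-central operator with scalar square acts through `χ` -/

section Abstract

variable [SeparatelyContinuousMul G]

/-- **Unique `χ`-scalar constituent + `ρ(t)` central in `ρ(G)` with `ρ(t)² = c` scalar ⇒ `ρ(t) = χ(t)`.**  Let `ρ` be smooth on `V` with every constituent equal to `⟦τ⟧`, `τ` irreducible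
with `τ.ρ g = χ(g)` (`hτ`); let `t ∈ G` with `ρ t (ρ t v) = c • v` (`hsq`) and `ρ g (ρ t v) = ρ t (ρ g v)` for all `g` (`hcomm`).  Then `ρ t v = χ(t) • v`.  (Eigenspace decomposition
`V = ker (ρ t − s) + ker (ρ t + s)`, `s² = c`, into `G`-subrepresentations; a non-zero one has the constituent `⟦τ⟧` on which `t` acts by both `±s` (§1) and `χ(t)`.)  No compactness,
no unitarity, no topology on `V`. [cite: BushnellHenniart2006, §2.3 Lemma; §9.1] [cite: BernsteinZelevinsky1976, §2.1–§2.3] -/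
theorem apply_eq_smul_of_forall_isConstituentOf_eq_of_sq {V : Type} [AddCommGroup V] [Module ℂ V]
    (ρ : Representation ℂ G V) (hρ : ρ.IsSmooth) (χ : G →* ℂˣ)
    (τ : SmoothIrrep G) (hτ : ∀ (g : G) (z : τ.V), τ.ρ g z = ((χ g : ℂˣ) : ℂ) • z)
    (hconst : ∀ c : IrrClass G, c.IsConstituentOf ρ → c = IrrClass.mk τ)
    (t : G) (c : ℂ) (hsq : ∀ v : V, ρ t (ρ t v) = c • v) (hcomm : ∀ (g : G) (v : V), ρ g (ρ t v) = ρ t (ρ g v)) (v : V) :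
    ρ t v = ((χ t : ℂˣ) : ℂ) • v := by
  obtain ⟨s, hs⟩ := IsAlgClosed.exists_eq_mul_self c
  -- the `ε`-eigenspace of `ρ t` as a subrepresentation (`ε = ± s`)
  let U : ℂ → Subrepresentation ρ := fun ε =>
    ⟨LinearMap.ker (ρ t - ε • LinearMap.id), fun g w hw => by
      rw [LinearMap.mem_ker, LinearMap.sub_apply, LinearMap.smul_apply, LinearMap.id_apply] at hw ⊢
      rw [← hcomm, sub_eq_zero.1 hw, map_smul, sub_self]⟩
  have hmemU : ∀ (ε : ℂ) (w : V), w ∈ U ε ↔ ρ t w = ε • w := fun ε w => by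
    change w ∈ LinearMap.ker (ρ t - ε • LinearMap.id) ↔ _
    rw [LinearMap.mem_ker, LinearMap.sub_apply, LinearMap.smul_apply, LinearMap.id_apply, sub_eq_zero]
  -- KEY: a non-zero eigenvector forces `ε = χ t`
  have key : ∀ (ε : ℂ) (w : V), w ∈ U ε → w ≠ 0 → ε = ((χ t : ℂˣ) : ℂ) := by
    intro ε w hw hw0
    haveI : Nontrivial ↥(U ε).toSubmodule := ⟨⟨⟨w, hw⟩, 0, fun h0 => hw0 (congrArg Subtype.val h0)⟩⟩
    obtain ⟨c₀, hc₀⟩ := IrrClass.exists_isConstituentOf (U ε).toRepresentation (hρ.toRepresentation (U ε))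
    have hc₀' : c₀ = IrrClass.mk τ := hconst c₀ (hc₀.of_subrepresentation (U ε))
    rw [hc₀'] at hc₀
    have hUt : ∀ y : ↥(U ε).toSubmodule, (U ε).toRepresentation t y = ε • y := fun y => Subtype.ext ((hmemU ε y).1 y.2)
    haveI : Nontrivial τ.V := nontrivial_of_isIrreducible τ.ρ
    obtain ⟨z, hz⟩ := exists_ne (0 : τ.V)
    have h1 := IsConstituentOf.apply_eq_smul_of_forall_apply_eq_smul hc₀ hUt z
    rw [hτ] at h1
    -- `χ t • z = ε • z` with `z ≠ 0`
    have h2 : (((χ t : ℂˣ) : ℂ) - ε) • z = 0 := by rw [sub_smul, h1, sub_self]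
    exact (eq_of_sub_eq_zero ((smul_eq_zero.1 h2).resolve_right hz)).symm
  -- the case `s = 0`: `ρ t (ρ t v) = 0` forces `v = 0`
  by_cases hs0 : s = 0
  · have hv : v = 0 := by
      have h0 : ρ t (ρ t v) = 0 := by rw [hsq, hs, hs0, mul_zero, zero_smul]
      exact (ρ.apply_bijective t).1 ((ρ.apply_bijective t).1 (by rw [h0, map_zero, map_zero]))
    rw [hv, map_zero, smul_zero]
  -- the eigen-decomposition `v = up + um`
  set up : V := (2 * s)⁻¹ • (ρ t v + s • v) with hup
  set um : V := (2 * s)⁻¹ • (s • v - ρ t v) with hum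
  have h2s : (2 * s) ≠ 0 := mul_ne_zero two_ne_zero hs0
  have hsum : up + um = v := by
    rw [hup, hum, ← smul_add, show ρ t v + s • v + (s • v - ρ t v) = (2 * s) • v by rw [mul_smul, two_smul]; abel, smul_smul,
      inv_mul_cancel₀ h2s, one_smul]
  have hplus : up ∈ U s := by
    rw [hmemU, hup, map_smul, map_add, map_smul, hsq, hs]
    module
  have hminus : um ∈ U (-s) := by
    rw [hmemU, hum, map_smul, map_sub, map_smul, hsq, hs]
    module
  -- each component is a `χ t`-eigenvector (either zero, or `key` pins its eigenvalue)
  have hcomp : ∀ (ε : ℂ) (w : V), w ∈ U ε → ρ t w = ((χ t : ℂˣ) : ℂ) • w := by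
    intro ε w hw
    by_cases hw0 : w = 0
    · rw [hw0, map_zero, smul_zero]
    · rw [(hmemU ε w).1 hw, key ε w hw hw0]
  rw [← hsum, map_add, hcomp s up hplus, hcomp (-s) um hminus, smul_add]

end Abstract

section OfChar

variable [IsTopologicalGroup G]

/-- **The same with `τ := ℂ_χ`** (★ `SmoothIrrep.ofChar χ hχ`, the currency of ★ `Realises₂` ∕ ★ `LocalConstituentsIn`): unique constituent `⟦ℂ_χ⟧`, `ρ(t)` central in `ρ(G)` with scalar
square ⇒ `ρ t v = χ(t) • v`. [cite: BushnellHenniart2006, §2.3 Lemma; §9.1] -/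
theorem apply_eq_smul_of_forall_isConstituentOf_eq_mk_ofChar_of_sq {V : Type} [AddCommGroup V] [Module ℂ V]
    (ρ : Representation ℂ G V) (hρ : ρ.IsSmooth) (χ : G →* ℂˣ) (hχ : IsOpen ((χ.ker : Subgroup G) : Set G))
    (hconst : ∀ c : IrrClass G, c.IsConstituentOf ρ → c = IrrClass.mk (SmoothIrrep.ofChar χ hχ))
    (t : G) (c : ℂ) (hsq : ∀ v : V, ρ t (ρ t v) = c • v) (hcomm : ∀ (g : G) (v : V), ρ g (ρ t v) = ρ t (ρ g v)) (v : V) :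
    ρ t v = ((χ t : ℂˣ) : ℂ) • v :=
  apply_eq_smul_of_forall_isConstituentOf_eq_of_sq ρ hρ χ (SmoothIrrep.ofChar χ hχ)
    (fun g z => by rw [SmoothIrrep.ofChar_ρ_apply]; rfl) hconst t c hsq hcomm v

/-- **`χ = 1`**: unique TRIVIAL constituent, `ρ(t)` central in `ρ(G)` with scalar square ⇒ `ρ t v = v`. [cite: BushnellHenniart2006, §2.3 Lemma] -/
theorem apply_eq_self_of_forall_isConstituentOf_eq_mk_ofChar_one_of_sq {V : Type} [AddCommGroup V] [Module ℂ V]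
    (ρ : Representation ℂ G V) (hρ : ρ.IsSmooth) (h1 : IsOpen (((1 : G →* ℂˣ).ker : Subgroup G) : Set G))
    (hconst : ∀ c : IrrClass G, c.IsConstituentOf ρ → c = IrrClass.mk (SmoothIrrep.ofChar 1 h1))
    (t : G) (c : ℂ) (hsq : ∀ v : V, ρ t (ρ t v) = c • v) (hcomm : ∀ (g : G) (v : V), ρ g (ρ t v) = ρ t (ρ g v)) (v : V) :
    ρ t v = v := by
  have h2 := apply_eq_smul_of_forall_isConstituentOf_eq_mk_ofChar_of_sq ρ hρ 1 h1 hconst t c hsq hcomm v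
  rwa [MonoidHom.one_apply, Units.val_one, one_smul] at h2

end OfChar

end IrrClass

end Literature.NumberTheory.Automorphic

end
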